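import Mathlib
import HarnessLib
import Summits.NavierStokesRegularity.NavierStokesRegularity.Theorems.UnthreadedRigidityDoorUnthreadedRigidityTwoShellPowerLawSign
import Summits.NavierStokesRegularity.NavierStokesRegularity.Theorems.UnthreadedRigidityDoorUnthreadedRigidityTwoShellLaneEmden

/-!
# Route `UnthreadedRigidityDoor`, item `UnthreadedRigidity` (W2, stmt-NavierStokesRegularity-27585) — LINE g12-1 «CO-ZONAL» rung family:
# ★★ THE POWER-LAW NONEXISTENCE IN EVERY DEGREE, and `TwoShellWindowRigidity l₁ l₂` FOR EVERY OPPOSITE-PARITY PAIR OF DEGREES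

Prover file (engine-1 g74; `--supports stmt-NavierStokesRegularity-27585 --as helper`; route-independent imports).

Assembly of the persistence road for two-shell windows of opposite parity (HOME engine/engine-1/RECORD-OF-CUSTODY-engine1-g74.md):
* ★ `eq_zero_of_bL_eq_zero_of_nonpos` — the branch `K·H ≤ 0` is EMPTY in every degree `L = m + 2` (no decay input): at a zero of `H` the orders
  forced by the power law (`(L+1)k = (L−1)h`, `k ≥ 1 ⇒ h ≥ 2`) give `H′ = 0`, so the first integral `E = L·H′² − (L+1)KH ≥ 0` (non-increasing)
  vanishes from there on, `H′ ≡ 0`, `K ≡ 0`, `H ≡ 0`; without zeros `H`, `K` have opposite strict signs and `no_positive_profile_with_negative_vorticity`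
  (file `…TwoShellLaneEmden`, applied to `H` or `−H`) is contradicted;
* ★★ `powerLawNonexistence` — EVERY degree `L = m + 2`: an admissible analytic profile with `b_L[H] ≡ 0` on `(0,∞)` vanishes there (sign dichotomy
  `constant_sign_of_bL_eq_zero` + the two branches; es-p1's `cubicLawNonexistence` is `L = 2`, `quarticLawNonexistence` / `quinticLawNonexistence`
  are `L = 3, 4`);
* ★ `twoShell_window_vanishes_consecutive` — two-shell windows of consecutive degrees (`l₁` odd, `l₂` even, `|l₁ − l₂| = 1`) VANISH: bridge M
  (P5), sphere relation (P6), sphere coefficients (`b_top ≡ 0`), `powerLawNonexistence` for the top profile (analytic by the parity read-off),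
  single-shell vanishing;
* ★★ `twoShellWindowRigidity_of_opposite_parity : 1 ≤ l₁ → 1 ≤ l₂ → Odd (l₁ + l₂) → CoZonal.TwoShellWindowRigidity l₁ l₂` — EVERY opposite-parity
  two-shell window rung of LINE g12-1 (gap `≥ 2`: p732884; consecutive: here), and `linkedPairWindowRigidity_of_opposite_parity` a fortiori.
What stays OPEN in the family `TwoShellWindowRigidity`: the SAME-PARITY pairs `l₁ ≠ l₂` (the parity read-off of bridge M does not separate the
shells; needs the bilinear cross-vorticity identity) — `(l,l)` is the tree theorem `CoZonal.twoShellWindowRigidity_sameDegree`.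

HONEST LABEL: RUNGS about SPECIAL hypothetical two-shell windows (the classes are EMPTY) + elementary ODE lemmas; support for `UnthreadedRigidity`
(27585), which stays OPEN with the door Target, W2 and Navier–Stokes regularity; no summit statement is proved.  MODEL/rung work; 0 kit.  [folklore]
-/

noncomputable section

-- the summit and its single sub-problem share the name (CONVENTIONS §1), as in every Theorems file
set_option linter.dupNamespace false

namespace Summit.NavierStokesRegularity.NavierStokesRegularity.Theorems.UnthreadedRigidity.MixedPair

open Set Function Filter Topology
open scoped RealInnerProductSpace
open Literature.Analysis Literature.Analysis.FluidPDE
open Literature.Analysis.UnboundedOperators (heatExtension)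
open Summit.NavierStokesRegularity.NavierStokesRegularity.Theorems.UnthreadedRigidity.ProfileHorn (E3)
open Summit.NavierStokesRegularity.NavierStokesRegularity.Theorems.UnthreadedRigidity.VirialHorn
  (IsSolidHarmonic VirialAdmissible sepShellL vortAmpL strainAmpL exists_skew_ne_zero window_analyticOnNhd_slice)
open Summit.NavierStokesRegularity.NavierStokesRegularity.Theorems.UnthreadedRigidity.ThreadingJets (analyticOnNhd_vortAmpL
  eq_zero_of_vortAmpL_eq_zero)
open Summit.NavierStokesRegularity.NavierStokesRegularity.Theorems.UnthreadedRigidity.CoZonal (twoShellL TwoShellWindowRigidity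
  LinkedPairWindowRigidity)
open Summit.NavierStokesRegularity.NavierStokesRegularity.Theorems.UnthreadedRigidity.Persistence (singleShellWindowVanishes sepShellL_null_of_pos)

/-! ## §1 ★ The branch `K·H ≤ 0` is empty; ★★ the power-law nonexistence in every degree -/

/-- ★ **THE BRANCH `K·H ≤ 0` IS EMPTY**, every degree `L = m + 2`: an admissible analytic profile with `b_L[H] ≡ 0` and `K·H ≤ 0` on `(0,∞)`
vanishes on `(0,∞)` — NO decay hypothesis (module docstring, steps 1–3). [folklore] -/
theorem eq_zero_of_bL_eq_zero_of_nonpos (m : ℕ) {H : ℝ → ℝ} (hH : VirialAdmissible (m + 2) H) (hHa : AnalyticOnNhd ℝ H (Set.Ioi 0))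
    (hb : ∀ r : ℝ, 0 < r →
      (((m + 2 : ℕ) : ℝ)) / (2 * r) * (((((m + 2 : ℕ) : ℝ)) - 1) * vortAmpL (m + 2) H r * deriv H r -
        ((((m + 2 : ℕ) : ℝ)) + 1) * deriv (vortAmpL (m + 2) H) r * H r) = 0)
    (hsign : ∀ r : ℝ, 0 < r → vortAmpL (m + 2) H r * H r ≤ 0) : ∀ r : ℝ, 0 < r → H r = 0 := by
  by_contra hne
  push Not at hne
  obtain ⟨r₀, hr₀, hH0⟩ := hne
  set K : ℝ → ℝ := vortAmpL (m + 2) H with hKdef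
  have hK : AnalyticOnNhd ℝ K (Ioi 0) := analyticOnNhd_vortAmpL hHa
  obtain ⟨C, hKC⟩ := powerLaw m H hH hHa hb
  have hC : C ≠ 0 := by
    rintro rfl
    have hK0 : ∀ r : ℝ, 0 < r → vortAmpL (m + 2) H r = 0 := fun r hr => by
      have h1 := hKC r hr
      rw [zero_mul] at h1
      exact (pow_eq_zero_iff (by omega)).1 h1
    exact hH0 (eq_zero_of_vortAmpL_eq_zero hH hK0 r₀ hr₀).1
  have hKne : ∀ r : ℝ, 0 < r → H r ≠ 0 → K r ≠ 0 := by
    intro r hr hHr hKr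
    have h1 := hKC r hr
    rw [show vortAmpL (m + 2) H r = K r from rfl, hKr, zero_pow (by omega)] at h1
    exact hHr ((pow_eq_zero_iff (by omega)).mp ((mul_eq_zero.mp h1.symm).resolve_left hC))
  -- STEP 1: `H` has no zero on `(0,∞)`
  have hnoZero : ∀ r : ℝ, 0 < r → H r ≠ 0 := by
    intro r₁ hr₁ hH1
    have hK1 : K r₁ = 0 := by
      have h1 := hKC r₁ hr₁
      rw [show vortAmpL (m + 2) H r₁ = K r₁ from rfl, hH1, zero_pow (by omega), mul_zero] at h1
      exact (pow_eq_zero_iff (by omega)).mp h1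
    have hHa₁ : AnalyticAt ℝ H r₁ := hHa r₁ hr₁
    have hKa₁ : AnalyticAt ℝ K r₁ := hK r₁ hr₁
    -- orders at `r₁`: `H′(r₁) = 0`
    have hHtop : analyticOrderAt H r₁ ≠ ⊤ := fun htop =>
      hH0 (hHa.eqOn_zero_of_preconnected_of_eventuallyEq_zero isPreconnected_Ioi hr₁ (analyticOrderAt_eq_top.mp htop) hr₀)
    have hKtop : analyticOrderAt K r₁ ≠ ⊤ := fun htop =>
      hKne r₀ hr₀ hH0 (hK.eqOn_zero_of_preconnected_of_eventuallyEq_zero isPreconnected_Ioi hr₁ (analyticOrderAt_eq_top.mp htop) hr₀)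
    obtain ⟨h, hh⟩ := ENat.ne_top_iff_exists.mp hHtop
    obtain ⟨k, hk⟩ := ENat.ne_top_iff_exists.mp hKtop
    have hlaw : (m + 3) * k = (m + 1) * h := by
      have e1 : analyticOrderAt (K ^ (m + 3)) r₁ = (m + 3) • analyticOrderAt K r₁ := analyticOrderAt_pow hKa₁ (m + 3)
      have e2 : analyticOrderAt ((fun _ : ℝ => C) * H ^ (m + 1)) r₁ = 0 + (m + 1) • analyticOrderAt H r₁ := by
        rw [analyticOrderAt_mul analyticAt_const (hHa₁.pow (m + 1)), analyticAt_const.analyticOrderAt_eq_zero.mpr hC,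
          analyticOrderAt_pow hHa₁ (m + 1)]
      have e3 : analyticOrderAt (K ^ (m + 3)) r₁ = analyticOrderAt ((fun _ : ℝ => C) * H ^ (m + 1)) r₁ := by
        apply analyticOrderAt_congr
        filter_upwards [Ioi_mem_nhds hr₁] with s hs
        simp only [Pi.pow_apply, Pi.mul_apply]
        exact hKC s hs
      rw [e1, e2, ← hk, ← hh, zero_add] at e3
      have e4 : (((m + 3) * k : ℕ) : ℕ∞) = (((m + 1) * h : ℕ) : ℕ∞) := by
        rw [Nat.cast_mul, Nat.cast_mul]
        simpa [nsmul_eq_mul] using e3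
      exact_mod_cast e4
    have hk1 : 1 ≤ k := by
      by_contra h0
      have hk0 : k = 0 := by omega
      rw [hk0, Nat.cast_zero] at hk
      exact ((hKa₁.analyticOrderAt_eq_zero).mp hk.symm) hK1
    have hh2 : 2 ≤ h := by
      by_contra h0
      have : h ≤ 1 := by omega
      have : (m + 3) * k ≤ (m + 1) * 1 := by rw [hlaw]; exact Nat.mul_le_mul_left _ this
      nlinarith
    have hderiv0 : deriv H r₁ = 0 := by
      have hord1 : analyticOrderAt (deriv H) r₁ = (h - 1 : ℕ) :=
        analyticOrderAt_deriv_of_pos hHa₁ (by rw [← hh]; norm_cast; omega)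
      exact apply_eq_zero_of_analyticOrderAt_ne_zero (by rw [hord1]; exact_mod_cast (by omega : h - 1 ≠ 0))
    -- the first integral is `≥ 0`, non-increasing, and `0` at `r₁`: `H′ ≡ 0` beyond `r₁`
    set E : ℝ → ℝ := fun s => ((m + 2 : ℕ) : ℝ) * deriv H s ^ 2 - (((m + 2 : ℕ) : ℝ) + 1) * (vortAmpL (m + 2) H s * H s) with hE
    have hEd : ∀ r, 0 < r → HasDerivAt E (-(4 * ((m + 2 : ℕ) : ℝ) * (((m + 2 : ℕ) : ℝ) + 1)) * deriv H r ^ 2 / r) r :=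
      fun r hr => hasDerivAt_firstIntegral (L := m + 2) (by omega) hHa hr (hb r hr)
    have hEanti : AntitoneOn E (Ioi 0) := by
      apply antitoneOn_of_deriv_nonpos (convex_Ioi 0)
      · exact fun r hr => (hEd r hr).continuousAt.continuousWithinAt
      · rw [interior_Ioi]; exact fun r hr => (hEd r hr).differentiableAt.differentiableWithinAt
      · rw [interior_Ioi]; intro r hr
        have hr' : 0 < r := hr
        rw [(hEd r hr').deriv]
        have : 0 ≤ 4 * ((m + 2 : ℕ) : ℝ) * (((m + 2 : ℕ) : ℝ) + 1) * deriv H r ^ 2 / r := by positivity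
        rw [neg_mul, neg_div]
        linarith
    have hE1 : E r₁ = 0 := by
      show ((m + 2 : ℕ) : ℝ) * deriv H r₁ ^ 2 - (((m + 2 : ℕ) : ℝ) + 1) * (vortAmpL (m + 2) H r₁ * H r₁) = 0
      rw [hderiv0, hH1]; ring
    have hH'zero : ∀ r, r₁ < r → deriv H r = 0 := by
      intro r hr
      have hr0 : 0 < r := lt_trans hr₁ hr
      have h1 : E r ≤ 0 := hE1 ▸ hEanti (mem_Ioi.2 hr₁) (mem_Ioi.2 hr0) hr.le
      have h2 : ((m + 2 : ℕ) : ℝ) * deriv H r ^ 2 ≤ 0 := by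
        have h3 : 0 ≤ -((((m + 2 : ℕ) : ℝ) + 1) * (vortAmpL (m + 2) H r * H r)) := by
          rw [← mul_neg]; exact mul_nonneg (by positivity) (by linarith [hsign r hr0])
        have h4 : E r = ((m + 2 : ℕ) : ℝ) * deriv H r ^ 2 - (((m + 2 : ℕ) : ℝ) + 1) * (vortAmpL (m + 2) H r * H r) := rfl
        linarith
      have h5 : deriv H r ^ 2 ≤ 0 := by
        have hL : (0 : ℝ) < ((m + 2 : ℕ) : ℝ) := by positivity
        nlinarith
      exact (pow_eq_zero_iff two_ne_zero).mp (le_antisymm h5 (sq_nonneg _))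
    have hKzero : ∀ r, r₁ < r → K r = 0 := by
      intro r hr
      have h1' : deriv H =ᶠ[𝓝 r] fun _ => (0 : ℝ) := by
        filter_upwards [Ioi_mem_nhds hr] with s hs
        exact hH'zero s hs
      have h2 : deriv (deriv H) r = 0 := by rw [h1'.deriv_eq]; simp
      show vortAmpL (m + 2) H r = 0
      unfold vortAmpL
      rw [h2, hH'zero r hr]; ring
    have hKev : K =ᶠ[𝓝 (r₁ + 1)] 0 := by
      filter_upwards [Ioi_mem_nhds (by linarith : r₁ < r₁ + 1)] with s hs
      exact hKzero s hs
    have hKall := hK.eqOn_zero_of_preconnected_of_eventuallyEq_zero isPreconnected_Ioi (by linarith : (0 : ℝ) < r₁ + 1) hKev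
    exact hKne r₀ hr₀ hH0 (hKall hr₀)
  -- STEP 2: constant strict signs, opposite
  have hKnoZero : ∀ r : ℝ, 0 < r → K r ≠ 0 := fun r hr => hKne r hr (hnoZero r hr)
  have hHsign := pos_or_neg_of_ne_zero hHa.continuousOn hnoZero
  have hKsign := pos_or_neg_of_ne_zero hK.continuousOn hKnoZero
  have hlawabs : ∀ r : ℝ, 0 < r → |K r| ^ (m + 3) = |C| * |H r| ^ (m + 1) := fun r hr => by
    rw [← abs_pow, show K r = vortAmpL (m + 2) H r from rfl, hKC r hr, abs_mul, abs_pow]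
  have hCabs : 0 < |C| := abs_pos.mpr hC
  -- STEP 3: the bootstrap, for `H` or for `−H`
  rcases hHsign with hHpos | hHneg
  · have hKneg : ∀ r : ℝ, 0 < r → K r < 0 := by
      rcases hKsign with hKp | hKn
      · exfalso
        have := hsign r₀ hr₀
        have h2 : 0 < K r₀ * H r₀ := mul_pos (hKp r₀ hr₀) (hHpos r₀ hr₀)
        exact absurd this (not_le.mpr h2)
      · exact hKn
    exact no_positive_profile_with_negative_vorticity m hH hHa hHpos hKneg hCabs
      (fun r hr => by rw [hlawabs r hr, abs_of_pos (hHpos r hr)])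
  · have hKpos : ∀ r : ℝ, 0 < r → 0 < K r := by
      rcases hKsign with hKp | hKn
      · exact hKp
      · exfalso
        have := hsign r₀ hr₀
        have h2 : 0 < K r₀ * H r₀ := mul_pos_of_neg_of_neg (hKn r₀ hr₀) (hHneg r₀ hr₀)
        exact absurd this (not_le.mpr h2)
    refine no_positive_profile_with_negative_vorticity m (virialAdmissible_neg hH) hHa.neg (fun r hr => by simpa using hHneg r hr)
      (fun r hr => by rw [vortAmpL_neg]; simpa using hKpos r hr) hCabs (fun r hr => ?_)
    rw [vortAmpL_neg, abs_neg, show vortAmpL (m + 2) H r = K r from rfl, hlawabs r hr, Pi.neg_apply, abs_of_neg (hHneg r hr)]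

/-- ★★ **POWER-LAW NONEXISTENCE, EVERY DEGREE** `L = m + 2` (es-p1's `cubicLawNonexistence` is `m = 0`): a virial-admissible profile, real-analytic
on `(0,∞)`, with `b_L[H] ≡ 0` there, vanishes on `(0,∞)` (sign dichotomy `constant_sign_of_bL_eq_zero`; branch `KH ≥ 0` by
`eq_zero_of_bL_eq_zero_of_nonneg`; branch `KH ≤ 0` by `eq_zero_of_bL_eq_zero_of_nonpos`). [folklore] -/
theorem powerLawNonexistence (m : ℕ) {H : ℝ → ℝ} (hH : VirialAdmissible (m + 2) H) (hHa : AnalyticOnNhd ℝ H (Set.Ioi 0))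
    (hb : ∀ r : ℝ, 0 < r →
      (((m + 2 : ℕ) : ℝ)) / (2 * r) * (((((m + 2 : ℕ) : ℝ)) - 1) * vortAmpL (m + 2) H r * deriv H r -
        ((((m + 2 : ℕ) : ℝ)) + 1) * deriv (vortAmpL (m + 2) H) r * H r) = 0) : ∀ r : ℝ, 0 < r → H r = 0 := by
  rcases constant_sign_of_bL_eq_zero m hH hHa hb with hpos | hneg
  · exact eq_zero_of_bL_eq_zero_of_nonneg (L := m + 2) (by omega) hH hHa (fun r hr => by exact_mod_cast hb r hr) hpos
  · exact eq_zero_of_bL_eq_zero_of_nonpos m hH hHa hb hneg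

/-! ## §2 ★★ Consecutive two-shell windows vanish, every degree; the opposite-parity table is complete -/

variable {S : Set ℝ} {u : ℝ → E3 → E3} {x₀ : E3}

/-- ★ **TWO-SHELL WINDOWS OF CONSECUTIVE DEGREES VANISH** (`l₁` odd, `l₂` even, `|l₁ − l₂| = 1`, every degree): the top profile has `b ≡ 0`
(`twoShell_sphere_coefficients`), hence is null (`powerLawNonexistence`), and single-shell windows vanish. -/
theorem twoShell_window_vanishes_consecutive (hS : IsOpen S) (hcont : ContinuousOn (uncurry u) (S ×ˢ univ))
    (hdiv : ∀ t ∈ S, VectorCalculus.IsDivFree (u t))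
    (hmild : ∀ s ∈ S, ∀ t ∈ S, s < t → ∀ x, u t x = heatExtension (u s) (t - s) x - oseenDuhamel 1 s u u t x)
    (hbdd : ∀ τ ∈ S, ∃ B : ℝ, ∀ t ∈ S, t ≤ τ → ∀ x, ‖u t x‖ ≤ B)
    {l₁ l₂ : ℕ} (hl₁ : Odd l₁) (hl₂ : Even l₂) (hd₁ : 1 ≤ l₁) (hd₂ : 1 ≤ l₂) (hcons : l₂ = l₁ + 1 ∨ l₁ = l₂ + 1)
    {Y₁ Y₂ : E3 → ℝ} (hY₁ : IsSolidHarmonic l₁ Y₁) (hY₂ : IsSolidHarmonic l₂ Y₂) (hY₁ne : ∃ y, Y₁ y ≠ 0) (hY₂ne : ∃ y, Y₂ y ≠ 0)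
    {H₁f H₂f : ℝ → ℝ → ℝ} (hH₁ : ∀ t ∈ S, VirialAdmissible l₁ (H₁f t)) (hH₂ : ∀ t ∈ S, VirialAdmissible l₂ (H₂f t))
    (hshape : ∀ t ∈ S, u t = twoShellL (H₁f t) (H₂f t) Y₁ Y₂ x₀) :
    ∀ t ∈ S, ∀ x, u t x = 0 := by
  have hsphere : ∀ t ∈ S, ∀ r : ℝ, 0 < r → ∃ e C : ℝ, ∀ w : E3, ‖w‖ = 1 →
      -(vortAmpL l₁ (H₁f t) r * strainAmpL l₁ (H₁f t) r) * (r ^ ((l₁ : ℤ) - 1)) ^ 2 * ‖gradient Y₁ w‖ ^ 2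
        + (l₁ : ℝ) / (2 * r) * (((l₁ : ℝ) - 1) * vortAmpL l₁ (H₁f t) r * deriv (H₁f t) r
            - ((l₁ : ℝ) + 1) * deriv (vortAmpL l₁ (H₁f t)) r * H₁f t r) * (r ^ l₁) ^ 2 * Y₁ w ^ 2
        + (-(vortAmpL l₂ (H₂f t) r * strainAmpL l₂ (H₂f t) r) * (r ^ ((l₂ : ℤ) - 1)) ^ 2 * ‖gradient Y₂ w‖ ^ 2
          + (l₂ : ℝ) / (2 * r) * (((l₂ : ℝ) - 1) * vortAmpL l₂ (H₂f t) r * deriv (H₂f t) r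
              - ((l₂ : ℝ) + 1) * deriv (vortAmpL l₂ (H₂f t)) r * H₂f t r) * (r ^ l₂) ^ 2 * Y₂ w ^ 2)
        - e * r ^ l₂ * Y₂ w = C := by
    intro t ht r hr
    have hbal := twoShell_window_toroidal_balance hS hcont hdiv hmild hbdd hl₁ hl₂ hY₁ hY₂ hH₁ hH₂ hshape ht
    rw [hshape t ht] at hbal
    exact twoShell_sphere_relation hl₁ hl₂ hd₁ hd₂ hY₁ hY₂ (hH₁ t ht) (hH₂ t ht) x₀ hbal hr
  have han : ∀ t ∈ S, AnalyticOnNhd ℝ (twoShellL (H₁f t) (H₂f t) Y₁ Y₂ x₀) univ := fun t ht => by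
    rw [← hshape t ht]; exact window_analyticOnNhd_slice hS hcont hmild hbdd ht
  rcases hcons with h12 | h21
  · -- top shell = shell 2 (even, degree `l₂ = l₁ + 1 = m + 2`)
    obtain ⟨m, hm⟩ : ∃ m, l₂ = m + 2 := ⟨l₂ - 2, by omega⟩
    subst hm
    have hH₂null : ∀ t ∈ S, ∀ r : ℝ, 0 < r → H₂f t r = 0 := by
      intro t ht
      refine powerLawNonexistence m (hH₂ t ht)
        (analyticOnNhd_twoShellProfile_even hl₁ hl₂ hd₁ hd₂ hY₁ hY₂ hY₂ne (hH₁ t ht) (hH₂ t ht) (han t ht)) fun r hr => ?_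
      obtain ⟨e, C, hrel⟩ := hsphere t ht r hr
      have hcoef := twoShell_sphere_coefficients (Y_T := Y₂) (Y_B := Y₁) (L := m + 2) (ℓ := l₁) hd₁ (by omega) hY₂ hY₁ hY₂ne
        (A_T := -(vortAmpL (m + 2) (H₂f t) r * strainAmpL (m + 2) (H₂f t) r) * (r ^ (((m + 2 : ℕ) : ℤ) - 1)) ^ 2)
        (B_T := ((m + 2 : ℕ) : ℝ) / (2 * r) * ((((m + 2 : ℕ) : ℝ) - 1) * vortAmpL (m + 2) (H₂f t) r * deriv (H₂f t) r
            - (((m + 2 : ℕ) : ℝ) + 1) * deriv (vortAmpL (m + 2) (H₂f t)) r * H₂f t r) * (r ^ (m + 2)) ^ 2)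
        (A_B := -(vortAmpL l₁ (H₁f t) r * strainAmpL l₁ (H₁f t) r) * (r ^ ((l₁ : ℤ) - 1)) ^ 2)
        (B_B := (l₁ : ℝ) / (2 * r) * (((l₁ : ℝ) - 1) * vortAmpL l₁ (H₁f t) r * deriv (H₁f t) r
            - ((l₁ : ℝ) + 1) * deriv (vortAmpL l₁ (H₁f t)) r * H₁f t r) * (r ^ l₁) ^ 2)
        (E_T := -(e * r ^ (m + 2))) (E_B := 0) (C₀ := C) (Or.inr hl₂) (Or.inl rfl)
        (fun w hw => by have h := hrel w hw; linear_combination h)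
      have hB := hcoef.1
      have hpow : (r ^ (m + 2)) ^ 2 ≠ 0 := by positivity
      exact (mul_eq_zero.mp hB).resolve_right hpow
    have hshape' : ∀ t ∈ S, u t = sepShellL (H₁f t) Y₁ x₀ := by
      intro t ht
      rw [hshape t ht]
      funext x
      show sepShellL (H₁f t) Y₁ x₀ x + sepShellL (H₂f t) Y₂ x₀ x = _
      rw [sepShellL_null_of_pos (H₂f t) Y₂ x₀ (hH₂null t ht) x, add_zero]
    exact singleShellWindowVanishes l₁ hd₁ S hS u x₀ hcont hdiv hmild hbdd Y₁ H₁f hY₁ hY₁ne hH₁ hshape'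
  · -- top shell = shell 1 (odd, degree `l₁ = l₂ + 1 = m + 2`)
    obtain ⟨m, hm⟩ : ∃ m, l₁ = m + 2 := ⟨l₁ - 2, by omega⟩
    subst hm
    have hH₁null : ∀ t ∈ S, ∀ r : ℝ, 0 < r → H₁f t r = 0 := by
      intro t ht
      refine powerLawNonexistence m (hH₁ t ht)
        (analyticOnNhd_twoShellProfile_odd hl₁ hl₂ hd₁ hd₂ hY₁ hY₂ hY₁ne (hH₁ t ht) (hH₂ t ht) (han t ht)) fun r hr => ?_
      obtain ⟨e, C, hrel⟩ := hsphere t ht r hr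
      have hcoef := twoShell_sphere_coefficients (Y_T := Y₁) (Y_B := Y₂) (L := m + 2) (ℓ := l₂) hd₂ (by omega) hY₁ hY₂ hY₁ne
        (A_T := -(vortAmpL (m + 2) (H₁f t) r * strainAmpL (m + 2) (H₁f t) r) * (r ^ (((m + 2 : ℕ) : ℤ) - 1)) ^ 2)
        (B_T := ((m + 2 : ℕ) : ℝ) / (2 * r) * ((((m + 2 : ℕ) : ℝ) - 1) * vortAmpL (m + 2) (H₁f t) r * deriv (H₁f t) r
            - (((m + 2 : ℕ) : ℝ) + 1) * deriv (vortAmpL (m + 2) (H₁f t)) r * H₁f t r) * (r ^ (m + 2)) ^ 2)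
        (A_B := -(vortAmpL l₂ (H₂f t) r * strainAmpL l₂ (H₂f t) r) * (r ^ ((l₂ : ℤ) - 1)) ^ 2)
        (B_B := (l₂ : ℝ) / (2 * r) * (((l₂ : ℝ) - 1) * vortAmpL l₂ (H₂f t) r * deriv (H₂f t) r
            - ((l₂ : ℝ) + 1) * deriv (vortAmpL l₂ (H₂f t)) r * H₂f t r) * (r ^ l₂) ^ 2)
        (E_T := 0) (E_B := -(e * r ^ l₂)) (C₀ := C) (Or.inl rfl) (Or.inr hl₂)
        (fun w hw => by have h := hrel w hw; linear_combination h)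
      have hB := hcoef.1
      have hpow : (r ^ (m + 2)) ^ 2 ≠ 0 := by positivity
      exact (mul_eq_zero.mp hB).resolve_right hpow
    have hshape' : ∀ t ∈ S, u t = sepShellL (H₂f t) Y₂ x₀ := by
      intro t ht
      rw [hshape t ht]
      funext x
      show sepShellL (H₁f t) Y₁ x₀ x + sepShellL (H₂f t) Y₂ x₀ x = _
      rw [sepShellL_null_of_pos (H₁f t) Y₁ x₀ (hH₁null t ht) x, zero_add]
    exact singleShellWindowVanishes l₂ hd₂ S hS u x₀ hcont hdiv hmild hbdd Y₂ H₂f hY₂ hY₂ne hH₂ hshape'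

/-- ★★ `TwoShellWindowRigidity l₁ l₂` for CONSECUTIVE degrees, `l₁` odd, `l₂` even. -/
theorem twoShellWindowRigidity_consecutive_odd_even {l₁ l₂ : ℕ} (hl₁ : Odd l₁) (hl₂ : Even l₂) (hd₁ : 1 ≤ l₁) (hd₂ : 1 ≤ l₂)
    (hcons : l₂ = l₁ + 1 ∨ l₁ = l₂ + 1) : TwoShellWindowRigidity l₁ l₂ := by
  intro S hS _ u x₀ hcont hdiv hmild hbdd _ Y₁ Y₂ H₁f H₂f hY₁ hY₂ hY₁ne hY₂ne hH₁ hH₂ hshape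
  have hzero := twoShell_window_vanishes_consecutive hS hcont hdiv hmild hbdd hl₁ hl₂ hd₁ hd₂ hcons hY₁ hY₂ hY₁ne hY₂ne hH₁ hH₂ hshape
  obtain ⟨A, hskew, hA0⟩ := exists_skew_ne_zero
  refine ⟨A, hskew, hA0, fun t ht x => ?_⟩
  have hut : u t = fun _ => (0 : E3) := funext (hzero t ht)
  rw [hut]
  simp

/-- ★★ **`TwoShellWindowRigidity l₁ l₂` FOR EVERY OPPOSITE-PARITY PAIR OF DEGREES `≥ 1`** — all such two-shell windows are EMPTY. -/
theorem twoShellWindowRigidity_of_opposite_parity {l₁ l₂ : ℕ} (hd₁ : 1 ≤ l₁) (hd₂ : 1 ≤ l₂) (hodd : Odd (l₁ + l₂)) :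
    TwoShellWindowRigidity l₁ l₂ := by
  have hpar : (Odd l₁ ∧ Even l₂) ∨ (Even l₁ ∧ Odd l₂) := by
    rcases Nat.even_or_odd l₁ with h1 | h1
    · right
      refine ⟨h1, ?_⟩
      rcases Nat.even_or_odd l₂ with h2 | h2
      · exact absurd hodd (Nat.not_odd_iff_even.mpr (h1.add h2))
      · exact h2
    · left
      refine ⟨h1, ?_⟩
      rcases Nat.even_or_odd l₂ with h2 | h2
      · exact h2
      · exact absurd hodd (Nat.not_odd_iff_even.mpr (h1.add_odd h2))
  by_cases hgap : l₁ + 2 ≤ l₂ ∨ l₂ + 2 ≤ l₁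
  · exact twoShellWindowRigidity_of_gap hd₁ hd₂ hpar hgap
  · have hne : l₁ ≠ l₂ := fun h => by rw [h, ← two_mul] at hodd; exact Nat.not_odd_iff_even.mpr (even_two_mul _) hodd
    have hcons : l₂ = l₁ + 1 ∨ l₁ = l₂ + 1 := by omega
    rcases hpar with ⟨h1, h2⟩ | ⟨h1, h2⟩
    · exact twoShellWindowRigidity_consecutive_odd_even h1 h2 hd₁ hd₂ hcons
    · intro S hS hconn u x₀ hcont hdiv hmild hbdd hunth Y₁ Y₂ H₁f H₂f hY₁ hY₂ hY₁ne hY₂ne hH₁ hH₂ hshape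
      refine twoShellWindowRigidity_consecutive_odd_even h2 h1 hd₂ hd₁ (by omega) S hS hconn u x₀ hcont hdiv hmild hbdd hunth Y₂ Y₁
        H₂f H₁f hY₂ hY₁ hY₂ne hY₁ne hH₂ hH₁ fun t ht => ?_
      rw [hshape t ht]
      funext x
      simp only [twoShellL]
      rw [add_comm]

/-- the residual R of LINE g12-1 for every opposite-parity pair, a fortiori. -/
theorem linkedPairWindowRigidity_of_opposite_parity {l₁ l₂ : ℕ} (hd₁ : 1 ≤ l₁) (hd₂ : 1 ≤ l₂) (hodd : Odd (l₁ + l₂)) :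
    LinkedPairWindowRigidity l₁ l₂ :=
  fun S hS hc u x₀ h1 h2 h3 h4 h5 Y₁ Y₂ H₁f H₂f hY₁ hY₂ hn₁ hn₂ _ hH₁ hH₂ hsh _ =>
    twoShellWindowRigidity_of_opposite_parity hd₁ hd₂ hodd S hS hc u x₀ h1 h2 h3 h4 h5 Y₁ Y₂ H₁f H₂f hY₁ hY₂ hn₁ hn₂ hH₁ hH₂ hsh

end Summit.NavierStokesRegularity.NavierStokesRegularity.Theorems.UnthreadedRigidity.MixedPair

end
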